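import Summits.BirchSwinnertonDyer.BirchSwinnertonDyer.Theorems.ByReductionTypeAtTwoRankOneAtTwoBigImageOddLocalOneDoorSubsliceNegDisc
import HarnessLib

/-!
# Route ByReductionTypeAtTwo, crux `RankOneAtTwoBigImageOddLocal` (stmt-BirchSwinnertonDyer-23715), LINE v8.15 `one_door_analytic`:
# THE LOSSLESSNESS GAP OF THE R⁻₀ SPLIT, MADE PRECISE — `BSD₂(W)` gives R⁻₀'s non-divisibility at every `Sel₂`-trivial transposition prime door
# WHOSE TWIN IS KNOWN TO BE ANALYTICALLY OF RANK `0`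

Lead prover seat `bsd-line-fkl-p1` g15 (2026-08-28), `--supports stmt-BirchSwinnertonDyer-23715` (helper).  THEOREMS ONLY; no definition, no named fact, no
`sorry`; conditional by design (Gross–Zagier, Kolyvagin, modularity, Hoffstein–Luo as hypotheses; `BSDp W 2` and `BSDp Wd 2` as hypotheses).  BSD is not
proved by any of this.

Skeleton v8.15 replaced the ∀∃ residue `DoorIndexLawFullCAtTwoSomeDoorOffSubslice` by R⁻₀ (`HeegnerNonDivisibilityAtSelmerTrivialPrimeDoorAtTwo`) and R₊.
`R⁻₀ ∧ R₊ ⟹ residue` is kernel-checked (`…OneDoorSubsliceNegDisc.lean` §4); in the other direction `residue ⟹ R₊` is verbatim, and this file proves the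
exact form of `BSD₂ ⟹ R⁻₀`: at a transposition-admissible door of a `Δ_W < 0`, `Ш(W)[2] = 0` curve with `#Sel₂(W^{(d_K)}) = 1`, an odd-constant datum and
a globally minimal twist model `Wd` with `BSDp Wd 2` AND `L(W^{(d_K)}, 1) ≠ 0`, `BSDp W 2` forces the Heegner point to be non-`2`-divisible modulo torsion
(`hasTwoDivisibilityUpToTorsion_zero_of_bsdp_two_at_transpDoor`): the per-datum kernel iff gives an exponent `m` with `2m + 1 = s_W + s_d + t + 2s + 2·v₂(c)`,
and `s_W = 0` (`Ш(W)[2] = 0 ⟹ Ш(W)[2^∞] = 0`, `primaryComponent_sha_two_eq_bot_of_shaTwoTrivial` — elementary, no finiteness needed), `s_d = 0` (`#Sel₂ = 1` on the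
minimal model, `twist_arith_of_selmerTrivial`), `t = 1`, `s = 0`, `v₂(c) = 0`, so `m = 0`.  The two displayed inputs on the twin — `L(W^{(d_K)},1) ≠ 0` and
`BSDp Wd 2` — are exactly the rank-`0` `2`-CONVERSE for the `Sel₂`-trivial twist followed by rank-`0` `BSD₂`; so «residue ⟹ R⁻₀» holds modulo the rank-`0`
`2`-converse and nothing else.  Nothing is asserted beyond that.

References: [Zhang2014CJM] Thm. 1.1; [GrossZagier1986] Thm. I.6.3, V.§2; [GrossLMS1991] §§2–3, §10; [SilvermanAEC2009] Thm. X.4.2.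
-/

set_option autoImplicit false
-- the Theorems namespace of this sub repeats the summit name by design (D-0017 nested layout)
set_option linter.dupNamespace false

noncomputable section

open scoped Classical

namespace Summit.BirchSwinnertonDyer.BirchSwinnertonDyer.Theorems.RankOneAtTwoOneDoor

open WeierstrassCurve NumberField Literature.NumberTheory.EllipticCurves Literature.NumberTheory.EllipticCurves.ModularForms
  Summit.BirchSwinnertonDyer.Rank1Residual.F1Sign2
  Summit.BirchSwinnertonDyer.Rank1Residual.F1Sign2.TranspositionDoor
  Summit.BirchSwinnertonDyer.BirchSwinnertonDyer.Theses.ByReductionTypeAtTwo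

/-! ### §1 `Ш(W)[2] = 0 ⟹ Ш(W)[2^∞] = 0` -/

/-- **A `2`-primary group without elements of order `2` is trivial**: `Ш(W)[2] = 0` (`ShaTwoTrivial W`) forces `Ш(W)[2^∞] = ⊥` (induction on the
exponent: if `2^{k+1} x = 0` then `2^k (2x) = 0`, so `2x = 0` by induction, so `x = 0` by `Ш[2] = 0`).  Elementary; no finiteness.
[cite: SilvermanAEC2009, Thm. X.4.2] -/
theorem primaryComponent_sha_two_eq_bot_of_shaTwoTrivial (W : WeierstrassCurve ℚ) [W.IsElliptic] (hSha : ShaTwoTrivial W) :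
    AddCommGroup.primaryComponent W.sha 2 = ⊥ := by
  haveI : Fact (Nat.Prime 2) := ⟨Nat.prime_two⟩
  -- every element killed by a power of `2` vanishes
  have key : ∀ (n : ℕ) (x : W.sha), 2 ^ n • x = 0 → x = 0 := by
    intro n
    induction n with
    | zero =>
      intro x hx
      rwa [pow_zero, one_smul] at hx
    | succ k ih =>
      intro x hx
      rw [pow_succ, mul_smul] at hx
      -- `hx : 2 ^ k • (2 • x) = 0`
      have h2x : 2 • x = 0 := ih _ hx
      have h2x' : 2 • (x : W.galH1) = 0 := by
        have h := congrArg Subtype.val h2x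
        simpa using h
      exact Subtype.ext (hSha x x.2 h2x')
  rw [eq_bot_iff]
  intro x hx
  obtain ⟨n, hn⟩ := (AddCommGroup.mem_primaryComponent).mp hx
  rw [AddSubgroup.mem_bot]
  exact key n x hn

/-- `Ш(W)[2] = 0 ⟹ ord₂ #Ш(W)[2^∞] = 0`. [cite: SilvermanAEC2009, Thm. X.4.2] -/
theorem padicValNat_card_primaryComponent_sha_two_eq_zero_of_shaTwoTrivial (W : WeierstrassCurve ℚ) [W.IsElliptic]
    (hSha : ShaTwoTrivial W) : padicValNat 2 (Nat.card (AddCommGroup.primaryComponent W.sha 2)) = 0 := by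
  haveI : Fact (Nat.Prime 2) := ⟨Nat.prime_two⟩
  rw [primaryComponent_sha_two_eq_bot_of_shaTwoTrivial W hSha, AddSubgroup.card_bot]
  simp

/-! ### §2 `BSD₂(W)` ⟹ non-divisibility at a `Sel₂`-trivial transposition prime door with a known rank-`0` twin -/

/-- **`BSDp W 2 ⟹ y_K ∉ 2E(K) + E(K)_tors` AT A `Sel₂`-TRIVIAL TRANSPOSITION PRIME DOOR WHOSE TWIN IS KNOWN** — the exact form of «residue ⟹ R⁻₀».
`W/ℚ` globally minimal, non-CM, odd torsion order, odd Tamagawa product, analytic rank `1`, `Δ_W < 0`, `Ш(W)[2] = 0`, and `BSDp W 2`; `K` imaginary quadratic with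
`(d_K, q₀)` transposition-admissible, `#Sel₂(W^{(d_K)}) = 1`, and the door NON-VANISHING `L(W^{(d_K)}, 1) ≠ 0`; an odd-constant datum `Dt`, `H`, `ι`, `P` over the
complex Heegner point; a globally minimal model `Wd` of the twist with `BSDp Wd 2`.  THEN `HasTwoDivisibilityUpToTorsion W K P 0`.  Proof: the per-datum kernel iff
(`bsdp_two_iff_doorLawFullC_at_of_rank`, modulo Gross–Zagier, Kolyvagin, modularity, Hoffstein–Luo for the rank) gives `m` with `2m + 1 = s_W + s_d + t + 2s + 2·v₂(c)`;
`s_W = 0` (§1), `s_d = 0` (`twist_arith_of_selmerTrivial`), `t = 1`, `s = 0` (`minimal_of_transpAdmissible`), `c` odd; so `m = 0`.  The inputs `L(W^{(d_K)},1) ≠ 0` and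
`BSDp Wd 2` are the rank-`0` `2`-converse for the `Sel₂`-trivial twist and rank-`0` `BSD₂`: modulo them (and print) v8.14's residue, the crux and R⁻₀ are equivalent on
the class.  CONDITIONAL by design; BSD is not proved by this. [cite: Zhang2014CJM, Thm. 1.1] [cite: GrossZagier1986, Thm. I.6.3 and V.§2] [cite: GrossLMS1991, Conj. 1.2 and §3] -/
theorem hasTwoDivisibilityUpToTorsion_zero_of_bsdp_two_at_transpDoor
    (hGZ : ∀ (N : ℕ) [NeZero N] (W : WeierstrassCurve ℚ) (K : Type) [Field K] [NumberField K], gross_zagier N W K)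
    (hKo : ∀ (N : ℕ) [NeZero N] (W : WeierstrassCurve ℚ) (K : Type) [Field K] [NumberField K], kolyvagin N W K)
    (hnf : exists_isNewformOf) (hHL : HoffsteinLuo1997_exists_twist_L_one_ne_zero)
    (W : WeierstrassCurve ℚ) [W.IsElliptic] [W.IsGloballyMinimal] [NeZero (W.conductorNorm ℤ)]
    (hT : Odd W.torsionOrder) (hc : Odd W.tamagawaProduct) (hr : W.analyticRank = 1) (hΔ : W.Δ < 0) (hSha : ShaTwoTrivial W)
    (hB : BSDp W 2)
    (K : Type) [Field K] [NumberField K] (hK : IsImaginaryQuadratic K) (q₀ : ℕ) [Fact q₀.Prime]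
    (htr : TranspAdmissible W (NumberField.discr K) q₀) (hsel : twistSelmerTwoCard W (NumberField.discr K) = 1)
    (hLt : (W.quadraticTwist (NumberField.discr K : ℚ)).entireLFunction 1 ≠ 0)
    (Dt : ModularParametrizationData W (W.conductorNorm ℤ)) (H : HeegnerDatum (W.conductorNorm ℤ) (NumberField.discr K))
    (ι : K →+* ℂ) (P : (W.baseChange K).toAffine.Point)
    (hP : WeierstrassCurve.Affine.Point.map ι.toRatAlgHom P = heegnerPointComplex Dt H) (hodd : Odd Dt.c)
    (Wd : WeierstrassCurve ℚ) [Wd.IsElliptic] [Wd.IsGloballyMinimal] (Cd : WeierstrassCurve.VariableChange ℚ)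
    (hWd : Cd • W.quadraticTwist (NumberField.discr K : ℚ) = Wd) (hBd : BSDp Wd 2) :
    HasTwoDivisibilityUpToTorsion W K P 0 := by
  haveI : Fact (Nat.Prime 2) := ⟨Nat.prime_two⟩
  have hmod : hasEntireLFunction_rat := hasEntireLFunction_rat_of_exists_isNewformOf hnf
  have hrk : W.mordellWeilRank = 1 :=
    (mordellWeilRank_eq_one_of_analyticRank_eq_one_of_isGloballyMinimal hGZ hKo hnf hHL W hr).1
  have hadm : DoorAdmissible W (NumberField.discr K) := ANg16.doorAdmissible_of_transpAdmissible W htr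
  have hHN : SatisfiesHeegnerHypothesis (W.conductorNorm ℤ) K := satisfiesHeegnerHypothesis_of_doorAdmissible W K hK hadm
  -- the per-datum equivalence, left to right
  obtain ⟨-, -, hiff⟩ :=
    bsdp_two_iff_doorLawFullC_at_of_rank hmod doorTwistTamagawaAtTwo W hT hc hr hrk K hK (hGZ _ W K) (hKo _ W K) hadm hHN hLt
      Dt H ι P hP Wd Cd hWd hBd
  obtain ⟨m, hm, hlaw⟩ := hiff.mp hB
  -- the five terms of the `Ш`-side
  have hsW : padicValNat 2 (Nat.card (AddCommGroup.primaryComponent W.sha 2)) = 0 :=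
    padicValNat_card_primaryComponent_sha_two_eq_zero_of_shaTwoTrivial W hSha
  have hD0 : (NumberField.discr K : ℚ) ≠ 0 := by exact_mod_cast NumberField.discr_ne_zero K
  obtain ⟨-, -, hbotd⟩ := twist_arith_of_selmerTrivial W hD0 hsel Wd Cd hWd
  have hsd : padicValNat 2 (Nat.card (AddCommGroup.primaryComponent Wd.sha 2)) = 0 := by
    rw [hbotd, AddSubgroup.card_bot]; simp
  have ht : transpCount W (NumberField.discr K) = 1 := transpCount_eq_one_of_transpAdmissible W htr
  have hs : identCount W (NumberField.discr K) = 0 := identCount_eq_zero_of_transpAdmissible W htr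
  have hc2 : ¬ (2 : ℤ) ∣ Dt.c := fun h => Int.not_even_iff_odd.mpr hodd (even_iff_two_dvd.mpr h)
  rw [hsW, hsd, ht, hs, padicValInt.eq_zero_of_not_dvd hc2, if_pos hΔ] at hlaw
  -- `2m + 1 = 0 + 0 + 1 + 0 + 0`
  have hm0 : m = 0 := by omega
  subst hm0
  exact hm

end Summit.BirchSwinnertonDyer.BirchSwinnertonDyer.Theorems.RankOneAtTwoOneDoor

end
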